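import Literature.NumberTheory.Rogawski1990.AdelicStableOrbitalEulerDischargeOfKConj
import Literature.NumberTheory.Rogawski1990.MatchingAdeleGKConjSemisimple
import Literature.NumberTheory.Automorphic.LocalSplitSemisimpleOrbitClosed
import Literature.NumberTheory.Automorphic.ArchSplitSemisimpleOrbitClosed
import HarnessLib

/-!
# The (xii-d) Euler discharge AT A SPLIT SEMISIMPLE CLASS `(γ₀ − a)(γ₀ − b) = 0`, `a ≠ b` — the K6-δ head with its three O7 binders CLOSED BY NAME
(Rogawski, *Automorphic Representations of Unitary Groups in Three Variables* (1990), §3.3 p. 21, §3.8 Prop. 3.8.1 p. 27, §4.3 p. 44, §5.4 (5.4.3)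
pp. 72–73; Kottwitz, *Stable trace formula: elliptic singular terms* (1986), Prop. 7.1, Cor. 7.3)

Topic `NumberTheory/Rogawski1990`; namespace `Literature.NumberTheory.Rogawski1990`.  THEOREMS ONLY: no definition, no named fact, no instance, no notation,
no `sorry`.  Cell `pub/hodgecm-mathlib`, ENGINE T1 (crux H413 = `stmt-HodgeConjecture-24833`), row O7 «singular semisimple stable classes», piece **K6-δ′**
(O7 OWNER WORD #9 (1)), sequel of ★ K6-δ `AdelicStableOrbitalEulerDischargeOfKConj`.

THE POINT.  ★ K6-δ `MatchingAdeleG.exists_isEulerOnClasses_ofLocalAdelic_of_eventuallyKConj` proves the Euler factorisation of the `G`-side adelic stable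
orbital integral over `𝒞_𝐀(γ₀)` for ANY rational `γ₀` with a rational correspondent `γ ∈ U(Φ₃)(L⁺)`, modulo three binders: the `K_v`-conjugacy clause
`hKCγ` at the pair, and the closedness `hO`, `hOi` of the `GL_3`-orbits of `γ_v` (every finite `v`) and of `γ ⊗ 1`.  At a SPLIT SEMISIMPLE class —
`(γ₀ − a)(γ₀ − b) = 0` in `M_3(L)` with `a ≠ b` (every singular semisimple and every central element of the anisotropic `U(H)(L⁺)`, [Rogawski1990, Prop.
3.8.1]) — all three are ★: `hKCγ` is ★ FILE 3 `MatchingAdeleG.eventuallyKConj_of_isSemisimpleElt` (Kottwitz 7.1 at semisimple pairs; semisimplicity from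
★ ε1 `isSemisimple_toLin'_of_mul_sub_eq_zero`), `hO` is ★ ε2 `isClosed_conjClass_localGL_of_mul_sub_eq_zero` and `hOi` is ★ ε∞
`isClosed_conjClass_mixedSpaceGL_of_mul_sub_eq_zero`, once the relation `(γ − a)(γ − b) = 0` is transported from `γ₀` to `γ` (conjugate in `GL_3(L)`) and
pushed to the components `γ_v ∈ GL_3(L ⊗ L⁺_v)` and `γ ⊗ 1 ∈ GL_3(L ⊗ ℝ)` (§1, entrywise ring homomorphisms).  §2 is the head with ONLY the kit-side
binders left: admissibility on the corresponding classes (`hadm`, `hadmA` — pin riders (ix-s)(xi-s)), normalisation (`hnormγ`, `hnorm`) and the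
integrability `hFi` (★-pending K6-ε𝔸 `MatchingAdeleG.integrable_descConj_out_of_mem_classes_of_eventuallyKConj` discharges it; an `hFi`-free corollary
follows as ED. 2).  HC_CM is proved only modulo the printed citations until rung 0 closes; this file consumes nothing printed.

* §1 `mul_sub_smul_mul_sub_smul_eq_zero_of_isConj` (transport along `GL`-conjugacy), `coe_toLocal_toAdelic_eq_map` ∕ `coe_cmRationalToArch_eq_map`
  (the component matrices are entrywise images), `mul_sub_smul_toLocal_toAdelic_eq_zero` ∕ `mul_sub_smul_cmRationalToArch_eq_zero` (the relation at `γ_v`,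
  `γ ⊗ 1`), `isUnit_algebraMap_localRing_sub` ∕ `isUnit_mixedEmbedding_sub` (`a − b` stays a unit).
* §2 **`MatchingAdeleG.exists_isEulerOnClasses_ofLocalAdelic_of_mul_sub_eq_zero`**.

## References
* [Rogawski1990] J. D. Rogawski, *Automorphic Representations of Unitary Groups in Three Variables*, Ann. of Math. Stud. 123 (1990), §3.3 p. 21, §3.8
  Prop. 3.8.1 p. 27, §4.3 p. 44, §5.4 (5.4.3) pp. 72–73.
* [Kottwitz1986] R. E. Kottwitz, *Stable trace formula: elliptic singular terms*, Math. Ann. 275 (1986), Prop. 7.1, Cor. 7.3, §7.3.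
* [GetzHahn2024] J. R. Getz, H. Hahn, *An Introduction to Automorphic Representations*, GTM 300 (2024), Thm. 17.4.1.
-/

set_option autoImplicit false

noncomputable section

open NumberField IsDedekindDomain Filter Function MeasureTheory
open scoped MatrixGroups

namespace Literature.NumberTheory.Rogawski1990

open Literature.NumberTheory.Automorphic Literature.LinearAlgebra.Matrix Literature.MeasureTheory.Group
open Literature.AlgebraicGeometry.ShimuraVarieties (unitaryGroup)

/-! ## §1 Transport and localisation of `(γ − a)(γ − b) = 0` -/

section Transport

/-- **`(γ − a)(γ − b) = 0` is a conjugacy invariant**: if `δ = c γ c⁻¹` in `GL_n(R)` then `(δ − a)(δ − b) = c (γ − a)(γ − b) c⁻¹ = 0`.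
[cite: Rogawski1990, §3.8 Prop. 3.8.1 p. 27] -/
theorem mul_sub_smul_mul_sub_smul_eq_zero_of_isConj {R : Type*} [CommRing R] {n : Type*} [Fintype n] [DecidableEq n]
    {γ δ : GL n R} (h : IsConj γ δ) {a b : R}
    (h0 : ((γ : Matrix n n R) - a • (1 : Matrix n n R)) * ((γ : Matrix n n R) - b • (1 : Matrix n n R)) = 0) :
    ((δ : Matrix n n R) - a • (1 : Matrix n n R)) * ((δ : Matrix n n R) - b • (1 : Matrix n n R)) = 0 := by
  obtain ⟨c, rfl⟩ := isConj_iff.1 h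
  have e : ∀ x : R, ((c * γ * c⁻¹ : GL n R) : Matrix n n R) - x • (1 : Matrix n n R) =
      (c : Matrix n n R) * ((γ : Matrix n n R) - x • (1 : Matrix n n R)) * ((c⁻¹ : GL n R) : Matrix n n R) := by
    intro x
    rw [Units.val_mul, Units.val_mul, mul_sub, sub_mul, Matrix.mul_smul, Matrix.mul_one, Matrix.smul_mul, Units.mul_inv]
  rw [e a, e b]
  calc (c : Matrix n n R) * ((γ : Matrix n n R) - a • 1) * ((c⁻¹ : GL n R) : Matrix n n R) *
        ((c : Matrix n n R) * ((γ : Matrix n n R) - b • 1) * ((c⁻¹ : GL n R) : Matrix n n R))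
      = (c : Matrix n n R) * (((γ : Matrix n n R) - a • 1) * (((c⁻¹ : GL n R) : Matrix n n R) * (c : Matrix n n R)) *
          ((γ : Matrix n n R) - b • 1)) * ((c⁻¹ : GL n R) : Matrix n n R) := by simp only [mul_assoc]
    _ = 0 := by rw [Units.inv_mul, mul_one, h0, mul_zero, zero_mul]

/-- Entrywise ring homomorphisms commute with `(· − a)(· − b)`: `((M − a)(M − b)).map f = (f(M) − f a)(f(M) − f b)` (the relation of [Rogawski1990, Prop.
3.8.1] read in any extension of scalars). [cite: Rogawski1990, §3.8 Prop. 3.8.1 p. 27] -/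
theorem map_mul_sub_smul_mul_sub_smul {R S : Type*} [CommRing R] [CommRing S] {n : Type*} [Fintype n] [DecidableEq n] (f : R →+* S)
    (M : Matrix n n R) (a b : R) :
    ((M - a • (1 : Matrix n n R)) * (M - b • (1 : Matrix n n R))).map f =
      (M.map f - f a • (1 : Matrix n n S)) * (M.map f - f b • (1 : Matrix n n S)) := by
  have h1 : ∀ x : R, (x • (1 : Matrix n n R)).map f = f x • (1 : Matrix n n S) := by
    intro x
    ext i j
    simp only [Matrix.map_apply, Matrix.smul_apply, Matrix.one_apply, smul_eq_mul, mul_ite, mul_one, mul_zero, apply_ite f,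
      map_zero]
  rw [Matrix.map_mul, Matrix.map_sub (f : R → S) (map_sub f), Matrix.map_sub (f : R → S) (map_sub f), h1 a, h1 b]

variable {L : Type} [Field L] [NumberField L] [IsCMField L] {N : ℕ} {H : Matrix (Fin N) (Fin N) L}

/-- **The matrix of `γ_v = (γ ⊗ 1)_v ∈ GL_N(L ⊗ L⁺_v)` is the entrywise image of `γ`** (★ `coe_cmDatum_toLocal`, ★ `coe_cmDatum_toAdelic`, ★ `val_toAdeleGL`
— all definitional — and ★ `adeleToLocal_comp_algebraMap`). [cite: PlatonovRapinchuk1994, §5.1] -/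
theorem coe_toLocal_toAdelic_eq_map (v : HeightOneSpectrum (𝓞 ↥(maximalRealSubfield L))) (γ : (UnitaryGroup.cmDatum L N H).Rational) :
    ((((UnitaryGroup.cmDatum L N H).toLocal v ((UnitaryGroup.cmDatum L N H).toAdelic γ)).val : GL (Fin N) (UnitaryGroup.LocalRing L v)).val :
        Matrix (Fin N) (Fin N) (UnitaryGroup.LocalRing L v)) =
      (((γ : unitaryGroup (cmConjRingHom L) H).val : GL (Fin N) L).val : Matrix (Fin N) (Fin N) L).map (algebraMap L (UnitaryGroup.LocalRing L v)) := by
  have hc : ((UnitaryGroup.adeleToLocal L v : AdeleRing (𝓞 L) L → UnitaryGroup.LocalRing L v) ∘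
      (algebraMap L (AdeleRing (𝓞 L) L) : L → AdeleRing (𝓞 L) L)) = (algebraMap L (UnitaryGroup.LocalRing L v) : L → UnitaryGroup.LocalRing L v) := by
    funext x
    exact DFunLike.congr_fun (UnitaryGroup.adeleToLocal_comp_algebraMap (E := L) v) x
  change ((((γ : unitaryGroup (cmConjRingHom L) H).val : GL (Fin N) L).val : Matrix (Fin N) (Fin N) L).map
      (algebraMap L (AdeleRing (𝓞 L) L))).map (UnitaryGroup.adeleToLocal L v) = _
  rw [Matrix.map_map, hc]

/-- **The matrix of `γ ⊗ 1 ∈ GL_N(L ⊗ ℝ)` (★ `cmRationalToArch`) is the entrywise image of `γ` under `mixedEmbedding`** (★ `coe_cmRationalToArch`, ★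
`coe_rationalToArch` — definitional). [cite: BorelJacquet1979, §4.1] -/
theorem coe_cmRationalToArch_eq_map (γ : (UnitaryGroup.cmDatum L N H).Rational) :
    (((cmRationalToArch L N H γ).val : GL (Fin N) (mixedEmbedding.mixedSpace L)).val : Matrix (Fin N) (Fin N) (mixedEmbedding.mixedSpace L)) =
      (((γ : unitaryGroup (cmConjRingHom L) H).val : GL (Fin N) L).val : Matrix (Fin N) (Fin N) L).map (mixedEmbedding L) :=
  rfl

/-- **`(γ_v − a)(γ_v − b) = 0` at every finite place** from `(γ − a)(γ − b) = 0` in `M_N(L)`. [cite: Rogawski1990, §3.8 Prop. 3.8.1 p. 27] -/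
theorem mul_sub_smul_toLocal_toAdelic_eq_zero (v : HeightOneSpectrum (𝓞 ↥(maximalRealSubfield L))) (γ : (UnitaryGroup.cmDatum L N H).Rational)
    {a b : L} (h : ((((γ : unitaryGroup (cmConjRingHom L) H).val : GL (Fin N) L).val : Matrix (Fin N) (Fin N) L) - a • (1 : Matrix (Fin N) (Fin N) L)) *
      ((((γ : unitaryGroup (cmConjRingHom L) H).val : GL (Fin N) L).val : Matrix (Fin N) (Fin N) L) - b • (1 : Matrix (Fin N) (Fin N) L)) = 0) :
    (((((UnitaryGroup.cmDatum L N H).toLocal v ((UnitaryGroup.cmDatum L N H).toAdelic γ)).val : GL (Fin N) (UnitaryGroup.LocalRing L v)).val :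
          Matrix (Fin N) (Fin N) (UnitaryGroup.LocalRing L v)) -
        algebraMap L (UnitaryGroup.LocalRing L v) a • (1 : Matrix (Fin N) (Fin N) (UnitaryGroup.LocalRing L v))) *
      (((((UnitaryGroup.cmDatum L N H).toLocal v ((UnitaryGroup.cmDatum L N H).toAdelic γ)).val : GL (Fin N) (UnitaryGroup.LocalRing L v)).val :
          Matrix (Fin N) (Fin N) (UnitaryGroup.LocalRing L v)) -
        algebraMap L (UnitaryGroup.LocalRing L v) b • (1 : Matrix (Fin N) (Fin N) (UnitaryGroup.LocalRing L v))) = 0 := by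
  rw [coe_toLocal_toAdelic_eq_map, ← map_mul_sub_smul_mul_sub_smul, h, Matrix.map_zero _ (map_zero _)]

/-- **`(γ ⊗ 1 − a)(γ ⊗ 1 − b) = 0` at the archimedean places** from `(γ − a)(γ − b) = 0` in `M_N(L)`. [cite: Rogawski1990, §3.8 Prop. 3.8.1 p. 27] -/
theorem mul_sub_smul_cmRationalToArch_eq_zero (γ : (UnitaryGroup.cmDatum L N H).Rational)
    {a b : L} (h : ((((γ : unitaryGroup (cmConjRingHom L) H).val : GL (Fin N) L).val : Matrix (Fin N) (Fin N) L) - a • (1 : Matrix (Fin N) (Fin N) L)) *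
      ((((γ : unitaryGroup (cmConjRingHom L) H).val : GL (Fin N) L).val : Matrix (Fin N) (Fin N) L) - b • (1 : Matrix (Fin N) (Fin N) L)) = 0) :
    ((((cmRationalToArch L N H γ).val : GL (Fin N) (mixedEmbedding.mixedSpace L)).val : Matrix (Fin N) (Fin N) (mixedEmbedding.mixedSpace L)) -
        mixedEmbedding L a • (1 : Matrix (Fin N) (Fin N) (mixedEmbedding.mixedSpace L))) *
      ((((cmRationalToArch L N H γ).val : GL (Fin N) (mixedEmbedding.mixedSpace L)).val : Matrix (Fin N) (Fin N) (mixedEmbedding.mixedSpace L)) -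
        mixedEmbedding L b • (1 : Matrix (Fin N) (Fin N) (mixedEmbedding.mixedSpace L))) = 0 := by
  rw [coe_cmRationalToArch_eq_map, ← map_mul_sub_smul_mul_sub_smul, h, Matrix.map_zero _ (map_zero _)]

omit [IsCMField L] in
/-- `a ≠ b` in `L` ⇒ `a − b` is a unit of `L ⊗ L⁺_v = ∏_{w∣v} L_w` (the diagonal embedding is a ring homomorphism out of a field).
[cite: PlatonovRapinchuk1994, §5.1] -/
theorem isUnit_algebraMap_localRing_sub (v : HeightOneSpectrum (𝓞 ↥(maximalRealSubfield L))) {a b : L} (hab : a ≠ b) :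
    IsUnit (algebraMap L (UnitaryGroup.LocalRing L v) a - algebraMap L (UnitaryGroup.LocalRing L v) b) := by
  rw [← map_sub]
  exact (IsUnit.mk0 _ (sub_ne_zero.2 hab)).map _

omit [NumberField L] [IsCMField L] in
/-- `a ≠ b` in `L` ⇒ `a − b` is a unit of `L ⊗ ℝ` (`mixedEmbedding` is a ring homomorphism out of a field). [cite: PlatonovRapinchuk1994, §5.1] -/
theorem isUnit_mixedEmbedding_sub {a b : L} (hab : a ≠ b) : IsUnit (mixedEmbedding L a - mixedEmbedding L b) := by
  rw [← map_sub]
  exact (IsUnit.mk0 _ (sub_ne_zero.2 hab)).map _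

end Transport

/-! ## §2 The head at a split semisimple class -/

section Discharge

variable {L : Type} [Field L] [NumberField L] [IsCMField L] {H : Matrix (Fin 3) (Fin 3) L}
  {γ₀ : (UnitaryGroup.cmDatum L 3 H).Rational}
  {γ : (UnitaryGroup.cmDatum L 3 (Matrix.of fun i j : Fin 3 => if i.val + j.val + 1 = 3 then (1 : L) else 0)).Rational}

variable {L : Type} [Field L] [NumberField L] [IsCMField L] {H : Matrix (Fin 3) (Fin 3) L}
  {γ₀ : (UnitaryGroup.cmDatum L 3 H).Rational}
  {γ : (UnitaryGroup.cmDatum L 3 (Matrix.of fun i j : Fin 3 => if i.val + j.val + 1 = 3 then (1 : L) else 0)).Rational}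
  [∀ g : (UnitaryGroup.cmDatum L 3 (Matrix.of fun i j : Fin 3 => if i.val + j.val + 1 = 3 then (1 : L) else 0)).Adelic,
    MeasurableSpace ((UnitaryGroup.cmDatum L 3 (Matrix.of fun i j : Fin 3 => if i.val + j.val + 1 = 3 then (1 : L) else 0)).Adelic ⧸
      Subgroup.centralizer ({g} : Set (UnitaryGroup.cmDatum L 3 (Matrix.of fun i j : Fin 3 => if i.val + j.val + 1 = 3 then (1 : L) else 0)).Adelic))]
  [∀ g : (UnitaryGroup.cmDatum L 3 (Matrix.of fun i j : Fin 3 => if i.val + j.val + 1 = 3 then (1 : L) else 0)).Adelic,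
    BorelSpace ((UnitaryGroup.cmDatum L 3 (Matrix.of fun i j : Fin 3 => if i.val + j.val + 1 = 3 then (1 : L) else 0)).Adelic ⧸
      Subgroup.centralizer ({g} : Set (UnitaryGroup.cmDatum L 3 (Matrix.of fun i j : Fin 3 => if i.val + j.val + 1 = 3 then (1 : L) else 0)).Adelic))]
  [∀ (v : HeightOneSpectrum (𝓞 ↥(maximalRealSubfield L)))
    (x : (UnitaryGroup.cmDatum L 3 (Matrix.of fun i j : Fin 3 => if i.val + j.val + 1 = 3 then (1 : L) else 0)).Local v),
    MeasurableSpace ((UnitaryGroup.cmDatum L 3 (Matrix.of fun i j : Fin 3 => if i.val + j.val + 1 = 3 then (1 : L) else 0)).Local v ⧸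
      Subgroup.centralizer ({x} : Set ((UnitaryGroup.cmDatum L 3 (Matrix.of fun i j : Fin 3 => if i.val + j.val + 1 = 3 then (1 : L) else 0)).Local v)))]
  [∀ (v : HeightOneSpectrum (𝓞 ↥(maximalRealSubfield L)))
    (x : (UnitaryGroup.cmDatum L 3 (Matrix.of fun i j : Fin 3 => if i.val + j.val + 1 = 3 then (1 : L) else 0)).Local v),
    BorelSpace ((UnitaryGroup.cmDatum L 3 (Matrix.of fun i j : Fin 3 => if i.val + j.val + 1 = 3 then (1 : L) else 0)).Local v ⧸
      Subgroup.centralizer ({x} : Set ((UnitaryGroup.cmDatum L 3 (Matrix.of fun i j : Fin 3 => if i.val + j.val + 1 = 3 then (1 : L) else 0)).Local v)))]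
  [∀ a : UnitaryGroup.arch (↥(maximalRealSubfield L)) L (IsCMField.complexConj L) 3 (Matrix.of fun i j : Fin 3 => if i.val + j.val + 1 = 3 then (1 : L) else 0),
    MeasurableSpace (UnitaryGroup.arch (↥(maximalRealSubfield L)) L (IsCMField.complexConj L) 3 (Matrix.of fun i j : Fin 3 => if i.val + j.val + 1 = 3 then (1 : L) else 0) ⧸
      Subgroup.centralizer ({a} : Set (UnitaryGroup.arch (↥(maximalRealSubfield L)) L (IsCMField.complexConj L) 3
        (Matrix.of fun i j : Fin 3 => if i.val + j.val + 1 = 3 then (1 : L) else 0))))]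
  [∀ a : UnitaryGroup.arch (↥(maximalRealSubfield L)) L (IsCMField.complexConj L) 3 (Matrix.of fun i j : Fin 3 => if i.val + j.val + 1 = 3 then (1 : L) else 0),
    BorelSpace (UnitaryGroup.arch (↥(maximalRealSubfield L)) L (IsCMField.complexConj L) 3 (Matrix.of fun i j : Fin 3 => if i.val + j.val + 1 = 3 then (1 : L) else 0) ⧸
      Subgroup.centralizer ({a} : Set (UnitaryGroup.arch (↥(maximalRealSubfield L)) L (IsCMField.complexConj L) 3
        (Matrix.of fun i j : Fin 3 => if i.val + j.val + 1 = 3 then (1 : L) else 0))))]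

/-- **THE (xii-d) EULER DISCHARGE AT A SPLIT SEMISIMPLE CLASS.**  `G = U(Φ₃)`; `γ₀ ∈ U(H)(L⁺)` with `(γ₀ − a)(γ₀ − b) = 0`, `a ≠ b ∈ L` (every singular
semisimple or central element of the anisotropic `U(H)`), `γ ∈ U(Φ₃)(L⁺)` a rational correspondent; local families `mq v` and an archimedean family `mqi`
ADMISSIBLE ON THE CLASSES CORRESPONDING TO `(γ₀)_v` ∕ `γ₀ ⊗ 1`; `mq` normalised off a finite set at `toAdelic γ` and at every matching adèle; an `IsTest` pure
tensor `T` with integrable orbital integrands at the classes of `𝒞_𝐀(γ₀)`.  THEN `∃ S₁, ∀ S ⊇ S₁, IsEulerOnClasses 𝒞_𝐀(γ₀) (ofLocalAdelic mq mqi) T.eval S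
(v ↦ Φ^st_v(γ_v)) (Φ^st_∞(γ ⊗ 1))` — ★ K6-δ with `hKCγ := MatchingAdeleG.eventuallyKConj_of_isSemisimpleElt` (★ FILE 3; semisimplicity ★ ε1),
`hO v := isClosed_conjClass_localGL_of_mul_sub_eq_zero` (★ ε2), `hOi := isClosed_conjClass_mixedSpaceGL_of_mul_sub_eq_zero` (★ ε∞) at the relation
transported to `γ` and its components (§1). [cite: Rogawski1990, §3.3 p. 21; §3.8 Prop. 3.8.1 p. 27; §4.3 p. 44; §5.4 (5.4.3) pp. 72–73]
[cite: Kottwitz1986, Prop. 7.1, Cor. 7.3] -/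
theorem MatchingAdeleG.exists_isEulerOnClasses_ofLocalAdelic_of_mul_sub_eq_zero
    (hγ : Corresponds (cmConjRingHom L) H (Matrix.of fun i j : Fin 3 => if i.val + j.val + 1 = 3 then (1 : L) else 0) γ₀ γ)
    {a b : L} (hab : a ≠ b)
    (hγab : ((((γ₀ : unitaryGroup (cmConjRingHom L) H).val : GL (Fin 3) L).val : Matrix (Fin 3) (Fin 3) L) - a • (1 : Matrix (Fin 3) (Fin 3) L)) *
      ((((γ₀ : unitaryGroup (cmConjRingHom L) H).val : GL (Fin 3) L).val : Matrix (Fin 3) (Fin 3) L) - b • (1 : Matrix (Fin 3) (Fin 3) L)) = 0)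
    (mq : ∀ v : HeightOneSpectrum (𝓞 ↥(maximalRealSubfield L)),
      OrbitalMeasureFamily ((UnitaryGroup.cmDatum L 3 (Matrix.of fun i j : Fin 3 => if i.val + j.val + 1 = 3 then (1 : L) else 0)).Local v))
    (mqi : OrbitalMeasureFamily (UnitaryGroup.arch (↥(maximalRealSubfield L)) L (IsCMField.complexConj L) 3
      (Matrix.of fun i j : Fin 3 => if i.val + j.val + 1 = 3 then (1 : L) else 0)))
    (hadm : ∀ v, (mq v).IsAdmissibleOn fun x : (UnitaryGroup.cmDatum L 3 (Matrix.of fun i j : Fin 3 => if i.val + j.val + 1 = 3 then (1 : L) else 0)).Local v =>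
      Corresponds (UnitaryGroup.conjLocal L (IsCMField.complexConj L) v)
        ((UnitaryGroup.adelicForm L 3 H).map (UnitaryGroup.adeleToLocal L v))
        ((UnitaryGroup.adelicForm L 3 (Matrix.of fun i j : Fin 3 => if i.val + j.val + 1 = 3 then (1 : L) else 0)).map (UnitaryGroup.adeleToLocal L v))
        ((UnitaryGroup.cmDatum L 3 H).toLocal v ((UnitaryGroup.cmDatum L 3 H).toAdelic γ₀)) x)
    (hadmA : mqi.IsAdmissibleOn fun a : UnitaryGroup.arch (↥(maximalRealSubfield L)) L (IsCMField.complexConj L) 3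
        (Matrix.of fun i j : Fin 3 => if i.val + j.val + 1 = 3 then (1 : L) else 0) =>
      Corresponds (UnitaryGroup.conjMixed (↥(maximalRealSubfield L)) L (IsCMField.complexConj L)) (UnitaryGroup.archFormOf L 3 H)
        (UnitaryGroup.archFormOf L 3 (Matrix.of fun i j : Fin 3 => if i.val + j.val + 1 = 3 then (1 : L) else 0)) (cmRationalToArch L 3 H γ₀) a)
    (hnormγ : ∃ S₀ : Finset (HeightOneSpectrum (𝓞 ↥(maximalRealSubfield L))),
      UnitaryGroup.IsNormalisedOff L 3 (Matrix.of fun i j : Fin 3 => if i.val + j.val + 1 = 3 then (1 : L) else 0) mq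
        ((UnitaryGroup.cmDatum L 3 (Matrix.of fun i j : Fin 3 => if i.val + j.val + 1 = 3 then (1 : L) else 0)).toAdelic γ) S₀)
    (hnorm : ∀ p : MatchingAdeleG L H γ₀, ∃ S₀ : Finset (HeightOneSpectrum (𝓞 ↥(maximalRealSubfield L))),
      UnitaryGroup.IsNormalisedOff L 3 (Matrix.of fun i j : Fin 3 => if i.val + j.val + 1 = 3 then (1 : L) else 0) mq p.adele S₀)
    (T : UnitaryGroup.PureTensor L 3 (Matrix.of fun i j : Fin 3 => if i.val + j.val + 1 = 3 then (1 : L) else 0)) (hT : T.IsTest)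
    (hFi : ∀ c ∈ MatchingAdeleG.classes L H γ₀, Integrable
      (descConj (Quotient.out c : (UnitaryGroup.cmDatum L 3 (Matrix.of fun i j : Fin 3 => if i.val + j.val + 1 = 3 then (1 : L) else 0)).Adelic)
        (Subgroup.centralizer ({(Quotient.out c : (UnitaryGroup.cmDatum L 3 (Matrix.of fun i j : Fin 3 => if i.val + j.val + 1 = 3 then (1 : L) else 0)).Adelic)} :
          Set (UnitaryGroup.cmDatum L 3 (Matrix.of fun i j : Fin 3 => if i.val + j.val + 1 = 3 then (1 : L) else 0)).Adelic))
        (centralizer_comm _) T.eval)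
      (UnitaryGroup.OrbitalMeasureFamily.ofLocalAdelic L 3 (Matrix.of fun i j : Fin 3 => if i.val + j.val + 1 = 3 then (1 : L) else 0) mq mqi c)) :
    ∃ S₁ : Finset (HeightOneSpectrum (𝓞 ↥(maximalRealSubfield L))), ∀ S : Finset (HeightOneSpectrum (𝓞 ↥(maximalRealSubfield L))), S₁ ⊆ S →
      IsEulerOnClasses (MatchingAdeleG.classes L H γ₀)
        (UnitaryGroup.OrbitalMeasureFamily.ofLocalAdelic L 3 (Matrix.of fun i j : Fin 3 => if i.val + j.val + 1 = 3 then (1 : L) else 0) mq mqi) T.eval S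
        (fun v => localStableOrbitalIntegral L 3 (Matrix.of fun i j : Fin 3 => if i.val + j.val + 1 = 3 then (1 : L) else 0) v (mq v) (T.loc v)
          ((UnitaryGroup.cmDatum L 3 (Matrix.of fun i j : Fin 3 => if i.val + j.val + 1 = 3 then (1 : L) else 0)).toLocal v
            ((UnitaryGroup.cmDatum L 3 (Matrix.of fun i j : Fin 3 => if i.val + j.val + 1 = 3 then (1 : L) else 0)).toAdelic γ)))
        (archStableOrbitalIntegral L 3 (Matrix.of fun i j : Fin 3 => if i.val + j.val + 1 = 3 then (1 : L) else 0) mqi T.arch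
          (cmRationalToArch L 3 (Matrix.of fun i j : Fin 3 => if i.val + j.val + 1 = 3 then (1 : L) else 0) γ)) := by
  -- the relation at the correspondent `γ` (conjugate to `γ₀` in `GL_3(L)`) and semisimplicity of `γ₀`
  have hγab' := mul_sub_smul_mul_sub_smul_eq_zero_of_isConj hγ hγab
  have hss : IsSemisimpleElt (cmConjRingHom L) H γ₀ := isSemisimple_toLin'_of_mul_sub_eq_zero hab hγab
  exact MatchingAdeleG.exists_isEulerOnClasses_ofLocalAdelic_of_eventuallyKConj hγ
    (MatchingAdeleG.eventuallyKConj_of_isSemisimpleElt hss hγ) mq mqi hadm hadmA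
    (fun v => UnitaryGroup.isClosed_conjClass_localGL_of_mul_sub_eq_zero 3 v _ (isUnit_algebraMap_localRing_sub v hab)
      (mul_sub_smul_toLocal_toAdelic_eq_zero v γ hγab'))
    (UnitaryGroup.isClosed_conjClass_mixedSpaceGL_of_mul_sub_eq_zero L 3 _ (isUnit_mixedEmbedding_sub hab)
      (mul_sub_smul_cmRationalToArch_eq_zero γ hγab'))
    hnormγ hnorm T hT hFi

end Discharge

end Literature.NumberTheory.Rogawski1990

end
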